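import Mathlib
import Literature.Combinatorics.Enumerative.EntringerBivariateEGF
import HarnessLib

/-!
# Hoffman's composition relations `P(P(u,t),s) = P(u,t+s)`, `Q(P(u,t),s)·Q(u,t) = Q(u,t+s)` as two-variable series

[cite: Hoffman1999DerivativePolynomials, §1 («dⁿ/dxⁿ tan x = Pₙ(tan x) and dⁿ/dxⁿ sec x = Qₙ(tan x) sec x»), §2 eq. (3) («P(P(u,t),s) = P(u,t+s) and Q(P(u,t),s)Q(u,t) = Q(u,t+s)»)]

The tree's `DerivativePolynomialCompositionRelations` types (3) through scalar specialisations (`tanAdd`).  With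
the Taylor shift `f(t) ↦ f(t+s)` of `EntringerBivariateEGF` (`taylorShift`, a ring homomorphism
`K⟦t⟧ → K⟦t⟧⟦s⟧`) the relations are typed here literally, as identities in `K⟦t⟧⟦s⟧`:

* `iterate_derivative_eq_aeval_P`: if `f′ = 1 + f²` then `f^{(n)} = Pₙ(f)`; `iterate_derivative_eq_aeval_Q_mul`: if
  moreover `g′ = g f` then `g^{(n)} = Qₙ(f)·g` (the defining property of the derivative polynomials, for formal series);
* hence **Taylor's theorem** `f(t+s) = Σₙ Pₙ(f(t)) sⁿ/n!`, `g(t+s) = Σₙ Qₙ(f(t)) g(t) sⁿ/n!` (`taylorShift_eq_of_deriv`,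
  `taylorShift_eq_of_deriv_mul`), in particular for `f = P(u,·)`, `g = Q(u,·)` (`∂P/∂t = 1 + P²`, `∂Q/∂t = QP`):
  ★ `P(P(u,t),s) = P(u,t+s)` (`compP_eq_taylorShift`) and ★ `Q(P(u,t),s)·Q(u,t) = Q(u,t+s)`
  (`compQ_mul_eq_taylorShift`); at `u = 0`: `tan(t+s) = Σ Pₙ(tan t) sⁿ/n!`, `sec(t+s) = Σ Qₙ(tan t) sec t sⁿ/n!`.
-/

namespace Literature.Combinatorics.Enumerative
namespace DerivativePolynomials

open PowerSeries Finset EntringerEGF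
open scoped Nat
open Literature.ComputerArithmetic.BrentZimmermann2010

variable {K : Type*} [Field K] [CharZero K]

/-! ### §1 `f^{(n)} = Pₙ(f)` and `g^{(n)} = Qₙ(f) g` -/

omit [CharZero K] in
/-- The derivative polynomials with coefficients in `K`. [cite: Hoffman1999DerivativePolynomials, §2 («P₀(u) = u and P_{n+1}(u) = (u²+1)Pₙ′(u)»)] -/
theorem map_P_succ (n : ℕ) : (TangentNumbers.P (n + 1)).map (Nat.castRingHom K) =
    (1 + Polynomial.X ^ 2) * Polynomial.derivative ((TangentNumbers.P n).map (Nat.castRingHom K)) := by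
  rw [TangentNumbers.P_succ, Polynomial.map_mul, Polynomial.derivative_map]
  simp

omit [CharZero K] in
/-- Same for `Q`: `Q_{n+1} = u Qₙ + (u²+1) Qₙ′`. [cite: Hoffman1999DerivativePolynomials, §2 («Q₀(u) = 1 and Q_{n+1}(u) = (u²+1)Qₙ′(u) + uQₙ(u)»)] -/
theorem map_Q_succ (n : ℕ) : (TangentNumbers.Q (n + 1)).map (Nat.castRingHom K) =
    Polynomial.X * (TangentNumbers.Q n).map (Nat.castRingHom K) +
      (1 + Polynomial.X ^ 2) * Polynomial.derivative ((TangentNumbers.Q n).map (Nat.castRingHom K)) := by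
  rw [TangentNumbers.Q, Polynomial.map_add, Polynomial.map_mul, Polynomial.map_mul, Polynomial.derivative_map]
  simp

omit [CharZero K] in
/-- Evaluating the `ℕ`-polynomial equals evaluating its image in `K[X]`. [folklore] -/
private theorem aeval_map_nat (f : K⟦X⟧) (p : Polynomial ℕ) :
    Polynomial.aeval f (p.map (Nat.castRingHom K)) = Polynomial.aeval f p := by
  rw [show Nat.castRingHom K = algebraMap ℕ K from rfl, Polynomial.aeval_map_algebraMap]

omit [CharZero K] in
/-- ★ **`f^{(n)} = Pₙ(f)` whenever `f′ = 1 + f²`** (the defining property `dⁿ tan/dxⁿ = Pₙ(tan)`, for formal series).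
[cite: Hoffman1999DerivativePolynomials, §1 («dⁿ/dxⁿ tan x = Pₙ(tan x)»)] -/
theorem iterate_derivative_eq_aeval_P {f : K⟦X⟧} (hf : d⁄dX K f = 1 + f ^ 2) : ∀ n : ℕ,
    (⇑(d⁄dX K))^[n] f = Polynomial.aeval f (TangentNumbers.P n)
  | 0 => by simp [TangentNumbers.P_zero]
  | n + 1 => by
      rw [Function.iterate_succ_apply', iterate_derivative_eq_aeval_P hf n, ← aeval_map_nat, ← aeval_map_nat,
        Derivation.map_aeval, hf, map_P_succ, map_mul, smul_eq_mul, mul_comm]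
      simp

omit [CharZero K] in
/-- ★ **`g^{(n)} = Qₙ(f)·g` whenever `f′ = 1 + f²` and `g′ = g f`** (`dⁿ sec/dxⁿ = Qₙ(tan) sec`, formally).
[cite: Hoffman1999DerivativePolynomials, §1 («dⁿ/dxⁿ sec x = Qₙ(tan x) sec x»)] -/
theorem iterate_derivative_eq_aeval_Q_mul {f g : K⟦X⟧} (hf : d⁄dX K f = 1 + f ^ 2) (hg : d⁄dX K g = g * f) :
    ∀ n : ℕ, (⇑(d⁄dX K))^[n] g = Polynomial.aeval f (TangentNumbers.Q n) * g
  | 0 => by simp [TangentNumbers.Q]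
  | n + 1 => by
      rw [Function.iterate_succ_apply', iterate_derivative_eq_aeval_Q_mul hf hg n, Derivation.leibniz, hg,
        ← aeval_map_nat f (TangentNumbers.Q n), ← aeval_map_nat f (TangentNumbers.Q (n + 1)), Derivation.map_aeval,
        hf, map_Q_succ, map_add, map_mul, map_mul, smul_eq_mul, smul_eq_mul]
      simp
      ring

/-! ### §2 Taylor's theorem: `f(t+s) = Σ Pₙ(f(t)) sⁿ/n!` -/

omit [CharZero K] in
/-- ★ **`f(t+s) = Σₙ Pₙ(f(t)) sⁿ/n!`** for `f′ = 1 + f²`. [cite: Hoffman1999DerivativePolynomials, §1–§2 (Taylor expansion behind eq. (1) and (3))] -/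
theorem taylorShift_eq_of_deriv {f : K⟦X⟧} (hf : d⁄dX K f = 1 + f ^ 2) :
    taylorShift f = PowerSeries.mk fun n => C ((n ! : K)⁻¹) * Polynomial.aeval f (TangentNumbers.P n) := by
  ext n : 1
  rw [coeff_taylorShift, coeff_mk, divDeriv, iterate_derivative_eq_aeval_P hf]

omit [CharZero K] in
/-- ★ **`g(t+s) = Σₙ Qₙ(f(t)) g(t) sⁿ/n!`** for `f′ = 1 + f²`, `g′ = g f`. [cite: Hoffman1999DerivativePolynomials, §1–§2] -/
theorem taylorShift_eq_of_deriv_mul {f g : K⟦X⟧} (hf : d⁄dX K f = 1 + f ^ 2) (hg : d⁄dX K g = g * f) :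
    taylorShift g = (PowerSeries.mk fun n => C ((n ! : K)⁻¹) * Polynomial.aeval f (TangentNumbers.Q n)) * C g := by
  ext n : 1
  rw [coeff_taylorShift, PowerSeries.coeff_mul_C, coeff_mk, divDeriv, iterate_derivative_eq_aeval_Q_mul hf hg, mul_assoc]

/-! ### §3 The composition relations (3) -/

/-- **`P(P(u,t),s) = Σₙ Pₙ(P(u,t)) sⁿ/n!`** as an element of `K⟦t⟧⟦s⟧. [cite: Hoffman1999DerivativePolynomials, §2 eq. (3)] -/
noncomputable def compP (u : K) : (K⟦X⟧)⟦X⟧ :=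
  PowerSeries.mk fun n => C ((n ! : K)⁻¹) * Polynomial.aeval (egfP u) (TangentNumbers.P n)

/-- **`Q(P(u,t),s) = Σₙ Qₙ(P(u,t)) sⁿ/n!`**. [cite: Hoffman1999DerivativePolynomials, §2 eq. (3)] -/
noncomputable def compQ (u : K) : (K⟦X⟧)⟦X⟧ :=
  PowerSeries.mk fun n => C ((n ! : K)⁻¹) * Polynomial.aeval (egfP u) (TangentNumbers.Q n)

/-- ★★ **Hoffman's first composition relation `P(P(u,t),s) = P(u,t+s)`** in `K⟦t⟧⟦s⟧.
[cite: Hoffman1999DerivativePolynomials, §2 eq. (3) («P(P(u,t),s) = P(u,t+s)»)] -/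
theorem compP_eq_taylorShift (u : K) : compP u = taylorShift (egfP u) := by
  rw [compP, taylorShift_eq_of_deriv (derivative_egfP u)]

/-- ★★ **Hoffman's second composition relation `Q(P(u,t),s)·Q(u,t) = Q(u,t+s)`** in `K⟦t⟧⟦s⟧.
[cite: Hoffman1999DerivativePolynomials, §2 eq. (3) («Q(P(u,t),s)Q(u,t) = Q(u,t+s)»)] -/
theorem compQ_mul_eq_taylorShift (u : K) : compQ u * C (egfQ u) = taylorShift (egfQ u) := by
  rw [compQ, taylorShift_eq_of_deriv_mul (derivative_egfP u) (derivative_egfQ u)]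

/-- ★ **`tan(t+s) = Σₙ Pₙ(tan t) sⁿ/n!`** (`tan = P(0,·)`). [cite: Hoffman1999DerivativePolynomials, §1 (Taylor's theorem with dⁿtan/dxⁿ = Pₙ(tan x), giving eq. (1))] -/
theorem taylorShift_tan : taylorShift (egfP (0 : K)) =
    PowerSeries.mk fun n => C ((n ! : K)⁻¹) * Polynomial.aeval (egfP (0 : K)) (TangentNumbers.P n) :=
  (compP_eq_taylorShift 0).symm

/-- ★ **`sec(t+s) = Σₙ Qₙ(tan t) sec t · sⁿ/n!`** (`sec = Q(0,·)`). [cite: Hoffman1999DerivativePolynomials, §1 (dⁿsec/dxⁿ = Qₙ(tan x) sec x)] -/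
theorem taylorShift_sec : taylorShift (egfQ (0 : K)) =
    (PowerSeries.mk fun n => C ((n ! : K)⁻¹) * Polynomial.aeval (egfP (0 : K)) (TangentNumbers.Q n)) * C (egfQ (0 : K)) :=
  (compQ_mul_eq_taylorShift 0).symm

/-- Coefficient form of (3)(i): `Pₙ(P(u,t)) = ∂ⁿP(u,t)/∂tⁿ`, i.e. `n!·[sⁿ] P(u,t+s) = Pₙ(P(u,t))`.
[cite: Hoffman1999DerivativePolynomials, §2 eq. (3)] -/
theorem aeval_egfP_P (u : K) (n : ℕ) : Polynomial.aeval (egfP u) (TangentNumbers.P n) = (⇑(d⁄dX K))^[n] (egfP u) :=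
  (iterate_derivative_eq_aeval_P (derivative_egfP u) n).symm

/-- Coefficient form of (3)(ii): `Qₙ(P(u,t))·Q(u,t) = ∂ⁿQ(u,t)/∂tⁿ`. [cite: Hoffman1999DerivativePolynomials, §2 eq. (3)] -/
theorem aeval_egfP_Q_mul (u : K) (n : ℕ) :
    Polynomial.aeval (egfP u) (TangentNumbers.Q n) * egfQ u = (⇑(d⁄dX K))^[n] (egfQ u) :=
  (iterate_derivative_eq_aeval_Q_mul (derivative_egfP u) (derivative_egfQ u) n).symm

end DerivativePolynomials
end Literature.Combinatorics.Enumerative
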